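/-
BALABAN–IMBRIE–JAFFE 1988 (CMP 114), §5.13 p.306 [PDF 50], the sentences leading to (5.13.3):

  «Each Φ contracts through a C_s to another Φ, to an f(□_i)_s or to ℱ. If a closed loop forms, or if a train of
  covariances beginning and ending in ℱ forms, then the term disappears with truncation. Thus we have only trains
  beginning with a δ/δΦ and ending in either δ/δΦ or ℱ. The sum over pairings and the sum over ways of arranging the
  contractions combine into a sum over walks {ω_α}_{α∈π} … involving the sites in α, an element of a partition π of Γ.»

STEP (iii) OF THE CONNECTED-DIAGRAM ROUTE TO (5.13.3) (corrected form, G-C2-24): REGROUPING THE CONNECTED DIAGRAMS BY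
THEIR TRAINS.  Step (ii) (`UrsellConnectedDiagrams.ursellOf_dmoment`, Gaussian instance
`BIJ88TruncationConnected306.ursellOf_gmoment`) expresses the truncated expectation of a product of leg monomials
against a smooth factor `H` as the sum over the CONNECTED leg diagrams `(D, τ)` on the vertex set `insertNone S`
(`none` = the smooth factor, `D` = the legs contracted into `H`, `τ` = the contraction pattern of the other legs).
Here we prove, purely combinatorially, that a connected diagram is the same thing as

  * a set partition `P` of the groups `S` (the vertex sets of the trains), together with
  * for every `c ∈ P` a PIECE on `c` (`pieces own c`): a NONEMPTY set `D_c` of legs of `c` contracted into the smooth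
    factor (*«trains beginning with a δ/δΦ»*) and a small contraction pattern of the remaining legs of `c` which is
    connected on `c` in the sense of `BIJ88ConnectedDiagrams312.IsConn` (p.311's components, here relative to the
    ambient leg set `legs c ∖ D_c`),

and that sums over connected diagrams regroup accordingly (`sum_conn_eq_sum_pieces`).  The two ingredients:

  * `isConn_iff_forall_atom` — THE BRIDGE between the two notions of connectedness in the tree: a diagram `(D, τ)` is
    connected through the smooth factor (`LegDiagram.IsConn`, separation closed under the `H`-vertex) iff every
    component of the contraction pattern `τ` (`BIJ88ConnectedDiagrams312.atom` over the ambient legs `legs S ∖ D`)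
    owns a leg of `D` (*«a train of covariances beginning and ending in ℱ … disappears with truncation»*);
  * `BIJ88ConnectedDiagrams312.sum_smallParts_eq_sum_comps` (the linked-cluster bijection of p.311–312), applied with
    the ambient leg set `legs S ∖ D`, and the independence of `IsConn` from the ambient leg set (`isConn_congr`).

The evaluation of the pieces as the print's trains `δ/δΦ C_s □Δ□ C_s ⋯ (½ δ/δΦ + ℱ)` is the next file.

## Main statements

* `pieces own c`, `mem_pieces` — the pieces (trains-to-be) on a group `c`.
* `isConn_iff_forall_atom` — the bridge.
* `sum_conn_eq_sum_pieces` — `Σ_{(D,τ) connected diagram on insertNone S} F D τ`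
  `= Σ_{P ∈ setPartitions S} Σ_{q ∈ Π_{c∈P} pieces c} F (⋃_c (q c).1) (⋃_c (q c).2)` for `F` vanishing on diagrams
  with a block of more than two legs (the Gaussian case, `BIJ88TruncationConnected306.prod_gw_eq_zero`).

statement-level skeleton of published theorems with citation tags; proofs where landed; nothing here is a claim
about the Yang–Mills mass gap

PDF held: `paper:balaban1988-cmp114-bij-abelian-higgs-effective-action` (journal page = PDF page + 256).

## References

* [BalabanImbrieJaffe1988] T. Bałaban, J. Imbrie, A. Jaffe, *Effective action and cluster properties of the abelian
  Higgs model*, Comm. Math. Phys. 114 (1988) 257–315, §5.13 p.305–306, §5.14 p.311–312.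
-/
import Literature.Probability.LatticeModels.UrsellConnectedDiagrams
import Literature.MathematicalPhysics.QuantumFieldTheory.BalabanImbrieJaffe1984to88.BIJ88ConnectedDiagrams312

namespace Literature.MathematicalPhysics.QuantumFieldTheory.BalabanImbrieJaffe1984to88.BIJ88ChainRegrouping306

open Finset Function
open scoped BigOperators
open Literature.Probability.LatticeModels
open BIJ88PairingAllOrders5133 (smallParts mem_smallParts)
open BIJ88IbpComponents312 (Splits)
open BIJ88ConnectedDiagrams312 (atom mem_atom atom_subset self_mem_atom atom_subset_of_splits splits_atom
  atom_biUnion_eq sum_smallParts_eq_sum_comps)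

-- `plegs T own c` = the legs of the group `c` inside the ambient leg set `T` (`BIJ88IbpComponents312.legs`);
-- `PConn T own c π` = the contraction pattern `π` is connected on the group `c` (`BIJ88ConnectedDiagrams312.IsConn`).
-- (Renamed on opening: `LegDiagram.legs` / `LegDiagram.IsConn` are the diagram-level notions of step (ii).)
open BIJ88IbpComponents312 renaming legs → plegs
open BIJ88ConnectedDiagrams312 renaming IsConn → PConn

variable {Λ : Type} [Fintype Λ] [LinearOrder Λ] {J : Type} [DecidableEq J]

/-! ## §1  Legs of a group; independence of `Splits`/`IsConn` from the ambient leg set -/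

section Legs

variable (own : Λ → J)

omit [LinearOrder Λ] in
/-- The legs of the vertex set `insertNone S` are the legs owned by the groups in `S`.
[cite: BalabanImbrieJaffe1988, §5.13 p.306] -/
theorem mem_legs_insertNone {S : Finset J} {l : Λ} : l ∈ LegDiagram.legs own (insertNone S) ↔ own l ∈ S := by
  rw [LegDiagram.mem_legs, Finset.some_mem_insertNone]

omit [LinearOrder Λ] in
/-- `legs (insertNone S) = {l | own l ∈ S}`. [cite: BalabanImbrieJaffe1988, §5.13 p.306] -/
theorem legs_insertNone_eq (S : Finset J) : LegDiagram.legs own (insertNone S) = plegs univ own S := by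
  ext l
  rw [mem_legs_insertNone, BIJ88IbpComponents312.mem_legs]
  simp only [mem_univ, true_and]

variable {own}

omit [LinearOrder Λ] in
/-- Relative to an ambient leg set inside the legs of `S`, the legs of `S` are the whole ambient set.
[cite: BalabanImbrieJaffe1988, §5.14 p.311] -/
theorem plegs_eq_self {S : Finset J} {T : Finset Λ} (hT : T ⊆ plegs univ own S) : plegs T own S = T := by
  ext l
  rw [BIJ88IbpComponents312.mem_legs]
  exact ⟨fun h => h.1, fun h => ⟨h, by simpa [BIJ88IbpComponents312.mem_legs] using hT h⟩⟩

/-- The legs of a subgroup `c ⊆ S` relative to `legs S ∖ D` are `legs c ∖ D`.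
[cite: BalabanImbrieJaffe1988, §5.14 p.311] -/
theorem plegs_sdiff {S c : Finset J} (hc : c ⊆ S) (D : Finset Λ) :
    plegs (plegs univ own S \ D) own c = plegs univ own c \ D := by
  ext l
  simp only [BIJ88IbpComponents312.mem_legs, mem_sdiff, mem_univ, true_and]
  exact ⟨fun h => ⟨h.2, h.1.2⟩, fun h => ⟨⟨hc h.1, h.2⟩, h.1⟩⟩

omit [Fintype Λ] [LinearOrder Λ] in
/-- `Splits` does not depend on the ambient leg set, as long as it contains the blocks.
[cite: BalabanImbrieJaffe1988, §5.14 p.311] -/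
theorem splits_congr {T T' : Finset Λ} {π : Finset (Finset Λ)} (h : ∀ B ∈ π, B ⊆ T) (h' : ∀ B ∈ π, B ⊆ T')
    (S' : Finset J) : Splits T own π S' ↔ Splits T' own π S' := by
  have key : ∀ {U U' : Finset Λ}, (∀ B ∈ π, B ⊆ U) → (∀ B ∈ π, B ⊆ U') → Splits U own π S' → Splits U' own π S' := by
    intro U U' hU hU' hs B hB
    rcases hs B hB with h1 | h1
    · refine Or.inl fun l hl => ?_
      rw [BIJ88IbpComponents312.mem_legs]
      exact ⟨hU' B hB hl, ((BIJ88IbpComponents312.mem_legs _ _).1 (h1 hl)).2⟩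
    · refine Or.inr (disjoint_left.2 fun l hl hl' => ?_)
      exact disjoint_left.1 h1 hl
        ((BIJ88IbpComponents312.mem_legs _ _).2 ⟨hU B hB hl, ((BIJ88IbpComponents312.mem_legs _ _).1 hl').2⟩)
  exact ⟨key h h', key h' h⟩

omit [Fintype Λ] [LinearOrder Λ] in
/-- `IsConn` does not depend on the ambient leg set, as long as it contains the blocks.
[cite: BalabanImbrieJaffe1988, §5.14 p.311] -/
theorem isConn_congr {T T' : Finset Λ} {π : Finset (Finset Λ)} (h : ∀ B ∈ π, B ⊆ T) (h' : ∀ B ∈ π, B ⊆ T')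
    (c : Finset J) : PConn T own c π ↔ PConn T' own c π := by
  unfold BIJ88ConnectedDiagrams312.IsConn
  exact forall_congr' fun S' => forall_congr' fun _ => forall_congr' fun _ => by rw [splits_congr h h' S']

variable (own)

/-- **The pieces on a group `c`** (the trains on the vertex set `c`, combinatorially): a nonempty set `D_c ⊆ legs c` of
legs contracted into the smooth factor (*«trains beginning with a δ/δΦ»*) and a small contraction pattern of
`legs c ∖ D_c` connected on `c`. [cite: BalabanImbrieJaffe1988, §5.13 p.306] -/
def pieces (c : Finset J) : Finset (Finset Λ × Finset (Finset Λ)) :=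
  ((plegs univ own c).powerset.erase ∅).biUnion fun Dc =>
    ((smallParts (plegs univ own c \ Dc)).filter (PConn (plegs univ own c \ Dc) own c)).image (Prod.mk Dc)

variable {own}

/-- membership in `pieces`. [cite: BalabanImbrieJaffe1988, §5.13 p.306] -/
theorem mem_pieces {c : Finset J} {q : Finset Λ × Finset (Finset Λ)} :
    q ∈ pieces own c ↔ q.1 ⊆ plegs univ own c ∧ q.1.Nonempty ∧ q.2 ∈ smallParts (plegs univ own c \ q.1)
      ∧ PConn (plegs univ own c \ q.1) own c q.2 := by
  constructor
  · intro h
    obtain ⟨Dc, hDc, hq⟩ := mem_biUnion.1 h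
    obtain ⟨π, hπ, rfl⟩ := mem_image.1 hq
    obtain ⟨hne, hsub⟩ := mem_erase.1 hDc
    exact ⟨mem_powerset.1 hsub, nonempty_iff_ne_empty.2 hne, (mem_filter.1 hπ).1, (mem_filter.1 hπ).2⟩
  · rintro ⟨h1, h2, h3, h4⟩
    exact mem_biUnion.2 ⟨q.1, mem_erase.2 ⟨h2.ne_empty, mem_powerset.2 h1⟩,
      mem_image.2 ⟨q.2, mem_filter.2 ⟨h3, h4⟩, rfl⟩⟩

end Legs

/-! ## §2  The bridge: connected through the smooth factor ⇔ every component owns a derivative leg -/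

section Bridge

variable {own : Λ → J}

/-- blocks inside `legs S ∖ D` lie in p25's legs of `S` relative to `legs S ∖ D`. [folklore] -/
private theorem blocks_sub {S : Finset J} {D : Finset Λ} {τ : Finset (Finset Λ)}
    (hτ : ∀ B ∈ τ, B ⊆ LegDiagram.legs own (insertNone S) \ D) :
    ∀ B ∈ τ, B ⊆ plegs (LegDiagram.legs own (insertNone S) \ D) own S := fun B hB l hl => by
  rw [BIJ88IbpComponents312.mem_legs]
  exact ⟨hτ B hB hl, (mem_legs_insertNone own).1 (mem_sdiff.1 (hτ B hB hl)).1⟩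

omit [DecidableEq J] in
/-- `some a ∈ c.map some ↔ a ∈ c`. [folklore] -/
private theorem some_mem_map_some {c : Finset J} {a : J} : some a ∈ c.map Embedding.some ↔ a ∈ c :=
  Finset.mem_map' Embedding.some

omit [DecidableEq J] in
/-- `none ∉ c.map some`. [folklore] -/
private theorem none_notMem_map_some {c : Finset J} : none ∉ c.map Embedding.some := fun h => by
  obtain ⟨a, -, ha⟩ := mem_map.1 h
  exact Option.some_ne_none a ha

/-- If the diagram is connected through the smooth factor, every component of its contraction pattern owns a leg
contracted into the smooth factor (*«a train of covariances beginning and ending in ℱ … disappears with truncation»*).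
[cite: BalabanImbrieJaffe1988, §5.13 p.306] -/
theorem forall_atom_of_isConn {S : Finset J} {D : Finset Λ} {τ : Finset (Finset Λ)}
    (hτ : ∀ B ∈ τ, B ⊆ LegDiagram.legs own (insertNone S) \ D)
    (h : LegDiagram.IsConn own (insertNone S) (D, τ)) :
    ∀ b ∈ S, ∃ l ∈ D, own l ∈ atom (LegDiagram.legs own (insertNone S) \ D) own S τ b := by
  intro b hb
  by_contra hno
  set T := LegDiagram.legs own (insertNone S) \ D with hTdef
  set c := atom T own S τ b with hcdef
  have hno' : ∀ l ∈ D, own l ∉ c := fun l hl hlc => hno ⟨l, hl, hlc⟩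
  have hsplit : Splits T own τ c := splits_atom (blocks_sub hτ) b
  have hsep : LegDiagram.Sep own (D, τ) (c.map Embedding.some) := by
    refine ⟨fun B hB => ?_, fun l hl => ?_⟩
    · rcases hsplit B hB with h1 | h1
      · refine Or.inl fun l hl => ?_
        rw [some_mem_map_some]
        exact ((BIJ88IbpComponents312.mem_legs _ _).1 (h1 hl)).2
      · refine Or.inr fun l hl hm => ?_
        rw [some_mem_map_some] at hm
        exact disjoint_left.1 h1 hl ((BIJ88IbpComponents312.mem_legs _ _).2 ⟨hτ B hB hl, hm⟩)
    · constructor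
      · intro hm
        rw [some_mem_map_some] at hm
        exact (hno' l hl hm).elim
      · exact fun hm => (none_notMem_map_some hm).elim
  have hQ : c.map Embedding.some ∈ (insertNone S).powerset := by
    rw [mem_powerset]
    intro q hq
    obtain ⟨a, ha, rfl⟩ := mem_map.1 hq
    exact Finset.some_mem_insertNone.2 (atom_subset _ _ _ ha)
  rcases h _ hQ hsep with h0 | h0
  · have hbQ : some b ∈ c.map Embedding.some := some_mem_map_some.2 (self_mem_atom τ hb)
    rw [h0] at hbQ
    exact notMem_empty _ hbQ
  · exact none_notMem_map_some (h0 ▸ Finset.none_mem_insertNone)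

/-- A separated vertex set avoiding the smooth factor is empty, if every component owns a derivative leg. [folklore] -/
private theorem sep_eq_empty {S : Finset J} {D : Finset Λ} {τ : Finset (Finset Λ)}
    (hτ : ∀ B ∈ τ, B ⊆ LegDiagram.legs own (insertNone S) \ D)
    (hat : ∀ b ∈ S, ∃ l ∈ D, own l ∈ atom (LegDiagram.legs own (insertNone S) \ D) own S τ b)
    {Q : Finset (Option J)} (hQ : Q ⊆ insertNone S) (hnQ : none ∉ Q) (hsep : LegDiagram.Sep own (D, τ) Q) :
    Q = ∅ := by
  by_contra hne
  obtain ⟨q, hq⟩ := nonempty_iff_ne_empty.2 hne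
  obtain ⟨b, rfl⟩ : ∃ b, q = some b := by
    cases q with
    | none => exact (hnQ hq).elim
    | some b => exact ⟨b, rfl⟩
  have hb : b ∈ S := Finset.some_mem_insertNone.1 (hQ hq)
  set T := LegDiagram.legs own (insertNone S) \ D with hTdef
  set S' := S.filter fun b' => some b' ∈ Q with hS'def
  have hsplit : Splits T own τ S' := by
    intro B hB
    rcases hsep.1 B hB with h1 | h1
    · refine Or.inl fun l hl => ?_
      rw [BIJ88IbpComponents312.mem_legs, hS'def, mem_filter]
      exact ⟨hτ B hB hl, (mem_legs_insertNone own).1 (mem_sdiff.1 (hτ B hB hl)).1, h1 l hl⟩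
    · refine Or.inr (disjoint_left.2 fun l hl hl' => ?_)
      rw [BIJ88IbpComponents312.mem_legs, hS'def, mem_filter] at hl'
      exact h1 l hl hl'.2.2
  have hsub : atom T own S τ b ⊆ S' :=
    atom_subset_of_splits (filter_subset _ S) (mem_filter.2 ⟨hb, hq⟩) hsplit
  obtain ⟨l, hl, hlc⟩ := hat b hb
  have h1 : some (own l) ∈ Q := (mem_filter.1 (hsub hlc)).2
  exact hnQ ((hsep.2 l hl).1 h1)

/-- **THE BRIDGE.** A diagram `(D, τ)` on `insertNone S` (legs `D` contracted into the smooth factor, contraction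
pattern `τ` of the other legs) is connected through the smooth factor iff every component of `τ` on `S` (relative
to the ambient legs `legs S ∖ D`) owns a leg of `D`: *«only trains beginning with a δ/δΦ»*.
[cite: BalabanImbrieJaffe1988, §5.13 p.306] -/
theorem isConn_iff_forall_atom {S : Finset J} {D : Finset Λ} {τ : Finset (Finset Λ)}
    (hD : D ⊆ LegDiagram.legs own (insertNone S)) (hτ : ∀ B ∈ τ, B ⊆ LegDiagram.legs own (insertNone S) \ D) :
    LegDiagram.IsConn own (insertNone S) (D, τ)
      ↔ ∀ b ∈ S, ∃ l ∈ D, own l ∈ atom (LegDiagram.legs own (insertNone S) \ D) own S τ b := by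
  refine ⟨forall_atom_of_isConn hτ, fun hat Q hQ hsep => ?_⟩
  rw [mem_powerset] at hQ
  by_cases hnQ : none ∈ Q
  · right
    -- the complement is separated and avoids the smooth factor
    have hsep' : LegDiagram.Sep own (D, τ) (insertNone S \ Q) := by
      refine ⟨fun B hB => ?_, fun l hl => ?_⟩
      · have hBV : ∀ l ∈ B, some (own l) ∈ insertNone S := fun l hl =>
          (LegDiagram.mem_legs own).1 (mem_sdiff.1 (hτ B hB hl)).1
        rcases hsep.1 B hB with h1 | h1
        · exact Or.inr fun l hl hm => (mem_sdiff.1 hm).2 (h1 l hl)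
        · exact Or.inl fun l hl => mem_sdiff.2 ⟨hBV l hl, h1 l hl⟩
      · have hlV : some (own l) ∈ insertNone S := (LegDiagram.mem_legs own).1 (hD hl)
        have := hsep.2 l hl
        simp only [mem_sdiff, hlV, Finset.none_mem_insertNone, true_and]
        exact not_congr this
    have he := sep_eq_empty hτ hat sdiff_subset (fun hm => (mem_sdiff.1 hm).2 hnQ) hsep'
    exact Subset.antisymm hQ fun v hv => by_contra fun hvQ => (notMem_empty v) (he ▸ mem_sdiff.2 ⟨hv, hvQ⟩)
  · exact Or.inl (sep_eq_empty hτ hat hQ hnQ hsep)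

end Bridge

/-! ## §3  Regrouping the connected diagrams by their pieces -/

section Regroup

variable {own : Λ → J}

/-- Step 1: connected diagrams as `(D, τ)` with `τ` small (the other terms vanish by hypothesis). [folklore] -/
private theorem step1 (S : Finset J) {M : Type*} [AddCommMonoid M] (F : Finset Λ → Finset (Finset Λ) → M)
    (hF : ∀ D τ, (D, τ) ∈ LegDiagram.diags own (insertNone S) → (∃ B ∈ τ, 2 < B.card) → F D τ = 0) :
    ∑ g ∈ (LegDiagram.diags own (insertNone S)).filter (LegDiagram.IsConn own (insertNone S)), F g.1 g.2
      = ∑ D ∈ (LegDiagram.legs own (insertNone S)).powerset,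
          ∑ τ ∈ smallParts (LegDiagram.legs own (insertNone S) \ D),
            if LegDiagram.IsConn own (insertNone S) (D, τ) then F D τ else 0 := by
  rw [sum_filter, LegDiagram.sum_diags]
  have hfilt : (LegDiagram.legs own (insertNone S)).powerset.filter (fun D => D.Nonempty → none ∈ insertNone S)
      = (LegDiagram.legs own (insertNone S)).powerset :=
    filter_true_of_mem fun D _ _ => Finset.none_mem_insertNone
  rw [hfilt]
  refine sum_congr rfl fun D hD => (sum_subset (fun τ hτ => mem_setPartitions.2 (mem_smallParts.1 hτ).1) ?_).symm
  intro τ hτ hτs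
  have hmem : (D, τ) ∈ LegDiagram.diags own (insertNone S) :=
    (LegDiagram.mem_diags own).2 ⟨mem_powerset.1 hD, fun _ => Finset.none_mem_insertNone, mem_setPartitions.1 hτ⟩
  have hbig : ∃ B ∈ τ, 2 < B.card := by
    by_contra hno
    refine hτs (mem_smallParts.2 ⟨mem_setPartitions.1 hτ, fun B hB => ?_⟩)
    by_contra hB2
    exact hno ⟨B, hB, not_le.1 hB2⟩
  simp only [hF D τ hmem hbig, ite_self]

/-- equality of `Finset.pi` domains from pointwise equality of the fibres. [folklore] -/
private theorem pi_congr_of_eq {X : Type*} {P : Finset (Finset J)} {t₁ t₂ : Finset J → Finset X}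
    (h : ∀ c ∈ P, t₁ c = t₂ c) : P.pi t₁ = P.pi t₂ := by
  ext f
  simp only [mem_pi]
  exact forall₂_congr fun c hc => by rw [h c hc]

/-- Step 2 (fixed `D`): the linked-cluster bijection of p.311–312 relative to the ambient legs `legs S ∖ D`, the bridge,
and the fibres in local form. [folklore] -/
private theorem step2 (S : Finset J) {M : Type*} [AddCommMonoid M] (F : Finset Λ → Finset (Finset Λ) → M)
    {D : Finset Λ} (hD : D ⊆ LegDiagram.legs own (insertNone S)) :
    ∑ τ ∈ smallParts (LegDiagram.legs own (insertNone S) \ D),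
        (if LegDiagram.IsConn own (insertNone S) (D, τ) then F D τ else 0)
      = ∑ P ∈ setPartitions S,
          ∑ f ∈ P.pi (fun c => (smallParts (plegs univ own c \ D)).filter (PConn (plegs univ own c \ D) own c)),
            if ∀ c ∈ P, ∃ l ∈ D, own l ∈ c then F D (P.attach.biUnion fun c => f c.1 c.2) else 0 := by
  set L := LegDiagram.legs own (insertNone S) with hL
  have hLS : L = plegs univ own S := legs_insertNone_eq own S
  have hT : L \ D ⊆ plegs univ own S := hLS ▸ sdiff_subset
  have key := sum_smallParts_eq_sum_comps (T := L \ D) (own := own) S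
    (fun τ => if LegDiagram.IsConn own (insertNone S) (D, τ) then F D τ else 0)
  rw [plegs_eq_self hT] at key
  rw [key]
  refine sum_congr rfl fun P hP => ?_
  have hPP : IsSetPartition S P := mem_setPartitions.1 hP
  -- the fibres in local form (independence of the ambient leg set)
  have hfib : ∀ c ∈ P, (smallParts (plegs (L \ D) own c)).filter (PConn (L \ D) own c)
      = (smallParts (plegs univ own c \ D)).filter (PConn (plegs univ own c \ D) own c) := by
    intro c hc
    have hcS : c ⊆ S := hPP.subset hc
    rw [hLS, plegs_sdiff hcS]
    refine filter_congr fun π hπ => isConn_congr (fun B hB l hl => ?_) (fun B hB => (mem_smallParts.1 hπ).1.subset hB) c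
    have hl' := (mem_smallParts.1 hπ).1.subset hB hl
    simp only [mem_sdiff, BIJ88IbpComponents312.mem_legs, mem_univ, true_and] at hl' ⊢
    exact ⟨hcS hl'.1, hl'.2⟩
  rw [← pi_congr_of_eq hfib]
  refine sum_congr rfl fun f hf => ?_
  rw [mem_pi] at hf
  have hf1 : ∀ c (hc : c ∈ P), f c hc ∈ smallParts (plegs (L \ D) own c) := fun c hc => (mem_filter.1 (hf c hc)).1
  have hf2 : ∀ c (hc : c ∈ P), PConn (L \ D) own c (f c hc) := fun c hc => (mem_filter.1 (hf c hc)).2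
  have hblk : ∀ B ∈ (P.attach.biUnion fun c => f c.1 c.2), B ⊆ L \ D := by
    intro B hB
    obtain ⟨c, -, hBc⟩ := mem_biUnion.1 hB
    exact ((mem_smallParts.1 (hf1 c.1 c.2)).1.subset hBc).trans (BIJ88IbpComponents312.legs_subset _ _ _)
  have hiff : LegDiagram.IsConn own (insertNone S) (D, P.attach.biUnion fun c => f c.1 c.2)
      ↔ ∀ c ∈ P, ∃ l ∈ D, own l ∈ c := by
    rw [isConn_iff_forall_atom hD hblk]
    constructor
    · intro h c hc
      obtain ⟨b, hb⟩ := hPP.nonempty_of_mem hc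
      obtain ⟨l, hl, hlb⟩ := h b (hPP.subset hc hb)
      rw [atom_biUnion_eq hPP f hf1 hf2 hc hb] at hlb
      exact ⟨l, hl, hlb⟩
    · intro h b hb
      obtain ⟨c, hc, hbc⟩ := hPP.exists_mem hb
      obtain ⟨l, hl, hlc⟩ := h c hc
      refine ⟨l, hl, ?_⟩
      rw [atom_biUnion_eq hPP f hf1 hf2 hc hbc]
      exact hlc
  by_cases hc : ∀ c ∈ P, ∃ l ∈ D, own l ∈ c
  · rw [if_pos hc, if_pos (hiff.2 hc)]
  · rw [if_neg hc, if_neg (mt hiff.1 hc)]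

/-- The legs of a component minus the derivative legs of all components are its legs minus its own derivative legs.
[folklore] -/
private theorem legs_sdiff_biUnion {S : Finset J} {P : Finset (Finset J)} (hPP : IsSetPartition S P)
    (d : ∀ c ∈ P, Finset Λ) (hd : ∀ c (hc : c ∈ P), d c hc ⊆ plegs univ own c) {c : Finset J} (hc : c ∈ P) :
    plegs univ own c \ (P.attach.biUnion fun c' => d c'.1 c'.2) = plegs univ own c \ d c hc := by
  ext l
  simp only [mem_sdiff, mem_biUnion, mem_attach, true_and, Subtype.exists, not_exists, and_congr_right_iff]
  intro hl
  constructor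
  · exact fun h => h c hc
  · intro h c' hc' hl'
    have h1 := (BIJ88IbpComponents312.mem_legs _ _).1 hl
    have h2 := (BIJ88IbpComponents312.mem_legs _ _).1 (hd c' hc' hl')
    have hcc : c' = c := hPP.eq_of_mem hc' hc h2.2 h1.2
    subst hcc
    exact h hl'

/-- The derivative legs of all components inside the legs of one component are its own derivative legs. [folklore] -/
private theorem biUnion_inter_legs {S : Finset J} {P : Finset (Finset J)} (hPP : IsSetPartition S P)
    (d : ∀ c ∈ P, Finset Λ) (hd : ∀ c (hc : c ∈ P), d c hc ⊆ plegs univ own c) {c : Finset J} (hc : c ∈ P) :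
    (P.attach.biUnion fun c' => d c'.1 c'.2) ∩ plegs univ own c = d c hc := by
  ext l
  simp only [mem_inter, mem_biUnion, mem_attach, true_and, Subtype.exists]
  constructor
  · rintro ⟨⟨c', hc', hl'⟩, hl⟩
    have h1 := (BIJ88IbpComponents312.mem_legs _ _).1 hl
    have h2 := (BIJ88IbpComponents312.mem_legs _ _).1 (hd c' hc' hl')
    have hcc : c' = c := hPP.eq_of_mem hc' hc h2.2 h1.2
    subst hcc
    exact hl'
  · exact fun h => ⟨⟨c, hc, h⟩, hd c hc h⟩

/-- A set of legs of `S` is the union of its parts in the legs of the components. [folklore] -/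
private theorem biUnion_inter_eq {S : Finset J} {P : Finset (Finset J)} (hPP : IsSetPartition S P)
    {D : Finset Λ} (hD : D ⊆ plegs univ own S) :
    (P.attach.biUnion fun c => D ∩ plegs univ own c.1) = D := by
  ext l
  simp only [mem_biUnion, mem_attach, true_and, Subtype.exists, mem_inter, exists_prop]
  constructor
  · rintro ⟨c, -, hl, -⟩
    exact hl
  · intro hl
    have h1 := (BIJ88IbpComponents312.mem_legs _ _).1 (hD hl)
    obtain ⟨c, hc, hlc⟩ := hPP.exists_mem h1.2
    exact ⟨c, hc, hl, (BIJ88IbpComponents312.mem_legs _ _).2 ⟨mem_univ _, hlc⟩⟩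

/-- Step 3 (fixed `P`): re-indexing `(D, f)` by the pieces `c ↦ (D ∩ legs c, f c)`. [folklore] -/
private theorem step3 (S : Finset J) {M : Type*} [AddCommMonoid M] (F : Finset Λ → Finset (Finset Λ) → M)
    {P : Finset (Finset J)} (hP : P ∈ setPartitions S) :
    ∑ D ∈ (plegs univ own S).powerset,
        ∑ f ∈ P.pi (fun c => (smallParts (plegs univ own c \ D)).filter (PConn (plegs univ own c \ D) own c)),
          (if ∀ c ∈ P, ∃ l ∈ D, own l ∈ c then F D (P.attach.biUnion fun c => f c.1 c.2) else 0)
      = ∑ q ∈ P.pi (fun c => pieces own c),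
          F (P.attach.biUnion fun c => (q c.1 c.2).1) (P.attach.biUnion fun c => (q c.1 c.2).2) := by
  have hPP : IsSetPartition S P := mem_setPartitions.1 hP
  -- the condition as a filter on `D`
  have e1 : ∀ D ∈ (plegs univ own S).powerset,
      (∑ f ∈ P.pi (fun c => (smallParts (plegs univ own c \ D)).filter (PConn (plegs univ own c \ D) own c)),
          (if ∀ c ∈ P, ∃ l ∈ D, own l ∈ c then F D (P.attach.biUnion fun c => f c.1 c.2) else 0))
        = if ∀ c ∈ P, ∃ l ∈ D, own l ∈ c then
            ∑ f ∈ P.pi (fun c => (smallParts (plegs univ own c \ D)).filter (PConn (plegs univ own c \ D) own c)),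
              F D (P.attach.biUnion fun c => f c.1 c.2) else 0 := by
    intro D _
    split_ifs
    · rfl
    · exact sum_const_zero
  rw [sum_congr rfl e1, ← sum_filter, sum_sigma']
  refine sum_nbij' (fun x => fun c (hc : c ∈ P) => (x.1 ∩ plegs univ own c, x.2 c hc))
    (fun q => ⟨P.attach.biUnion fun c => (q c.1 c.2).1, fun c hc => (q c hc).2⟩) ?_ ?_ ?_ ?_ ?_
  · -- into the pieces
    intro x hx
    obtain ⟨hx1, hx2⟩ := mem_sigma.1 hx
    obtain ⟨hDL, hcond⟩ := mem_filter.1 hx1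
    rw [mem_pi] at hx2 ⊢
    intro c hc
    obtain ⟨hs, hcn⟩ := mem_filter.1 (hx2 c hc)
    refine mem_pieces.2 ⟨inter_subset_right, ?_, ?_, ?_⟩
    · obtain ⟨l, hl, hlc⟩ := hcond c hc
      exact ⟨l, mem_inter.2 ⟨hl, (BIJ88IbpComponents312.mem_legs _ _).2 ⟨mem_univ _, hlc⟩⟩⟩
    · simpa only [sdiff_inter_self_right] using hs
    · simpa only [sdiff_inter_self_right] using hcn
  · -- from the pieces
    intro q hq
    rw [mem_pi] at hq
    have hq' : ∀ c (hc : c ∈ P), (q c hc).1 ⊆ plegs univ own c := fun c hc => (mem_pieces.1 (hq c hc)).1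
    refine mem_sigma.2 ⟨mem_filter.2 ⟨mem_powerset.2 ?_, fun c hc => ?_⟩, mem_pi.2 fun c hc => ?_⟩
    · intro l hl
      obtain ⟨c, -, hlc⟩ := mem_biUnion.1 hl
      exact BIJ88IbpComponents312.legs_mono _ _ (hPP.subset c.2) (hq' c.1 c.2 hlc)
    · obtain ⟨l, hl⟩ := (mem_pieces.1 (hq c hc)).2.1
      exact ⟨l, mem_biUnion.2 ⟨⟨c, hc⟩, mem_attach _ _, hl⟩, ((BIJ88IbpComponents312.mem_legs _ _).1 (hq' c hc hl)).2⟩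
    · have e := legs_sdiff_biUnion hPP (fun c hc => (q c hc).1) hq' hc
      rw [e]
      exact mem_filter.2 ⟨(mem_pieces.1 (hq c hc)).2.2.1, (mem_pieces.1 (hq c hc)).2.2.2⟩
  · -- left inverse
    intro x hx
    obtain ⟨hx1, -⟩ := mem_sigma.1 hx
    have hDL := mem_powerset.1 (mem_filter.1 hx1).1
    exact Sigma.ext (biUnion_inter_eq hPP hDL) HEq.rfl
  · -- right inverse
    intro q hq
    rw [mem_pi] at hq
    have hq' : ∀ c (hc : c ∈ P), (q c hc).1 ⊆ plegs univ own c := fun c hc => (mem_pieces.1 (hq c hc)).1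
    funext c hc
    have e := biUnion_inter_legs hPP (fun c hc => (q c hc).1) hq' hc
    exact Prod.ext e rfl
  · -- the summand
    intro x hx
    obtain ⟨hx1, -⟩ := mem_sigma.1 hx
    have hDL := mem_powerset.1 (mem_filter.1 hx1).1
    have e := biUnion_inter_eq (own := own) hPP hDL
    simp only [e]

/-- **THE CONNECTED DIAGRAMS REGROUPED BY THEIR TRAINS.** For a summand `F` vanishing on diagrams with a block of more
than two legs (the Gaussian case), the sum over the diagrams on `insertNone S` connected through the smooth factor is
the sum over the set partitions `P` of the groups `S` (*«an element of a partition π of Γ»*) and, for every `c ∈ P`,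
over the pieces on `c` (a nonempty set of legs of `c` into the smooth factor and a connected small contraction of the
other legs of `c`: *«trains beginning with a δ/δΦ and ending in either δ/δΦ or ℱ»*), the diagram being the union
of its pieces. [cite: BalabanImbrieJaffe1988, §5.13 p.306] -/
theorem sum_conn_eq_sum_pieces (S : Finset J) {M : Type*} [AddCommMonoid M] (F : Finset Λ → Finset (Finset Λ) → M)
    (hF : ∀ D τ, (D, τ) ∈ LegDiagram.diags own (insertNone S) → (∃ B ∈ τ, 2 < B.card) → F D τ = 0) :
    ∑ g ∈ (LegDiagram.diags own (insertNone S)).filter (LegDiagram.IsConn own (insertNone S)), F g.1 g.2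
      = ∑ P ∈ setPartitions S, ∑ q ∈ P.pi (fun c => pieces own c),
          F (P.attach.biUnion fun c => (q c.1 c.2).1) (P.attach.biUnion fun c => (q c.1 c.2).2) := by
  rw [step1 S F hF, sum_congr rfl fun D hD => step2 S F (mem_powerset.1 hD), sum_comm, legs_insertNone_eq]
  exact sum_congr rfl fun P hP => step3 S F hP

end Regroup

end Literature.MathematicalPhysics.QuantumFieldTheory.BalabanImbrieJaffe1984to88.BIJ88ChainRegrouping306
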